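import Literature.NumberTheory.EllipticCurves.KatzPAdicLFunctionCMFieldBaseChangeLine
import Literature.NumberTheory.GaloisRepresentations.ArtinRestriction
import Literature.NumberTheory.GaloisRepresentations.ArtinCharacterReciprocity
import Literature.NumberTheory.NumberFields.IdelicArtinMapNormCompatibility
import Literature.NumberTheory.AdelicBaseChange.AdeleNormGalois
import HarnessLib

/-!
# The `p`-adic avatar of `φ ∘ N_{L/K}` is the restriction of the avatar of `φ` — discharge of the
# named fact `isPAdicAvatarOf_compRelNorm` (`KatzPAdicLFunctionCMFieldBaseChangeLine.lean`, (B3))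

Topic `NumberTheory/EllipticCurves`; a PROOFS file (theorems only: no definition, no named fact) next to
`KatzPAdicLFunctionCMFieldBaseChangeLine.lean`, DISCHARGING its one named fact
`isPAdicAvatarOf_compRelNorm` (declared debt −1) and thereby making the bridge
`KatzCM.IsLine.isBaseChangeLine` and the existence statement `KatzCM.exists_isBaseChangeLine`
unconditional in that fact (`KatzCM.IsLine.isBaseChangeLine'`, `KatzCM.exists_isBaseChangeLine'`).

Statement proved (`isPAdicAvatarOf_compRelNorm_holds`): for `L/K` finite Galois, `φ` a Hecke
character of `K` unramified at every finite place with `p`-adic avatar `r` (`IsPAdicAvatarOf ι φ r`: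
at `v ∤ p`, `r` unramified with arithmetic-Frobenius characteristic polynomial `X − ι⁻¹(φ(ϖ_v))⁻¹`),
the restriction `r|_{Γ_L}` is the avatar of `φ ∘ N_{L/K}` (`HeckeCharacter.compRelNorm`).

Proof, at a place `w ∤ p` of `L` above `v = w ∩ K`:
* `r|_{Γ_L}` is unramified at `w` — `FramedGaloisRep.isUnramifiedAt_restrictField` (`ArtinRestriction`);
* `(φ ∘ N)(ϖ_w) = φ(ϖ_v)^{f(w|v)}` — `HeckeCharacter.valueAtUniformizer_eq_pow_of_forall_eq_ideleRelNorm`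
  (`IdelicArtinMapNormCompatibility`, Cassels–Fröhlich II (19.22): `|N⟨ϖ_w⟩|_v = |ϖ_w|^{f}`, valid at
  places RAMIFIED in `L/K` as well), after identifying the Galois-descent idèle norm behind
  `compRelNorm` with Cassels's norm (`AdelicBaseChange.automorphic_ideleRelNorm_eq`);
* a Frobenius `τ` of `L` at `𝔔 ∣ w` restricts to `Φ^{f(w|v)}` modulo `I_𝔓` for a Frobenius `Φ` of `K` at
  `𝔓 = ι⁻¹𝔔`, hence `r(res τ) = r(Φ)^{f}` for `r` unramified at `v` — the tree's
  `FramedGaloisRep.exists_restrictField_apply_eq_pow` (`ArtinRestriction`; Neukirch I (9.4)–(9.5));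
* rank one: `HasFrobCharpolyAt v (X − C a)` is "`r(Φ)₀₀ = a` at every Frobenius"
  (`FramedGaloisRep.hasFrobCharpolyAt_iff_of_rank_one`), and `(g^f)₀₀ = (g₀₀)^f` in `GL₁`
  (`gl_one_pow_apply`); so `r|_{Γ_L}(τ)₀₀ = a^f = (ι⁻¹(φ(ϖ_v)^f))⁻¹ = (ι⁻¹((φ∘N)(ϖ_w)))⁻¹`.
A Frobenius at `𝔓` exists by the discharged `HeightOneSpectrum.exists_isArithFrobAt_of_mem_primesAbove_holds`.

References: [NeukirchANT1999] Ch. I §9 (9.4)–(9.5) (decomposition and inertia, Frobenius);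
[CasselsFrohlichANT1967] Ch. II §19 (19.22), Ch. VII Prop. 4.3 (`ψ ∘ N`); [SerreAbelianLadic1968]
Ch. I §2.1, Ch. II §2.7 (avatars). Requested by the lead of crux `EisensteinHeartFlatCMInertBadKPrime`
(route `BiquadraticEisensteinDescent`, `Summits/BirchSwinnertonDyer`): the dictionary step of (E1a) on the
`K′`-line. Nothing here concerns any case of BSD.
-/

noncomputable section

open scoped Classical
open NumberField IsDedekindDomain Field Polynomial
open Literature.NumberTheory.GaloisRepresentations
open Literature.NumberTheory.AdelicBaseChange (automorphic_ideleRelNorm_eq)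

namespace Literature.NumberTheory.EllipticCurves

/-! ### §1. The discharge -/

section Discharge

/-- The `(0,0)` entry of a power in `GL₁` is the power of the entry (via `det`, `Matrix.det_fin_one`).
[cite: SerreAbelianLadic1968, Ch. I §2.1] -/
theorem gl_one_pow_apply {A : Type*} [CommRing A] (g : GL (Fin 1) A) (f : ℕ) :
    ((g ^ f : GL (Fin 1) A) : Matrix (Fin 1) (Fin 1) A) 0 0 =
      (((g : Matrix (Fin 1) (Fin 1) A)) 0 0) ^ f := by
  have h1 : ∀ M : Matrix (Fin 1) (Fin 1) A, M 0 0 = M.det := fun M ↦ (Matrix.det_fin_one M).symm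
  rw [h1 ((g ^ f : GL (Fin 1) A) : Matrix (Fin 1) (Fin 1) A), h1 (g : Matrix (Fin 1) (Fin 1) A),
    Units.val_pow_eq_pow_val, Matrix.det_pow]

/-- **DISCHARGE of `isPAdicAvatarOf_compRelNorm`**: for `L/K` finite Galois, `φ` a Hecke character of
`K` unramified everywhere with `p`-adic avatar `r` (`IsPAdicAvatarOf ι φ r`), the restriction
`r|_{Γ_L}` is the avatar of `φ ∘ N_{L/K}`. At a place `w ∤ p` above `v`: `r|_{Γ_L}` is unramified at
`w` (`FramedGaloisRep.isUnramifiedAt_restrictField`); `(φ ∘ N)(ϖ_w) = φ(ϖ_v)^{f(w|v)}`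
(`HeckeCharacter.valueAtUniformizer_eq_pow_of_forall_eq_ideleRelNorm` — Cassels–Fröhlich II (19.22),
valid at ramified `v` too — with the identification of the tree's two idelic norms,
`automorphic_ideleRelNorm_eq`); and a Frobenius `τ` of `L` at `𝔔 ∣ w` has
`r(res τ) = r(Φ)^{f}` for a Frobenius `Φ` of `K` below, whose `GL₁`-entry is
`(ι⁻¹φ(ϖ_v))^{−f}` by the rank-one reading `FramedGaloisRep.hasFrobCharpolyAt_iff_of_rank_one`
(`r(res τ) = r(Φ)^{f}`: the tree's `FramedGaloisRep.exists_restrictField_apply_eq_pow`).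
[cite: CasselsFrohlichANT1967, Ch. II §19 (19.22) and Ch. VII Prop. 4.3] [cite: SerreAbelianLadic1968, Ch. II §2.7] -/
theorem isPAdicAvatarOf_compRelNorm_holds : isPAdicAvatarOf_compRelNorm := by
  intro K L _ _ _ _ _ _ p _ ι φ r hr hφ w hpw _hunrw
  haveI : Algebra.IsAlgebraic K L := Algebra.IsAlgebraic.tower_top (K := ℚ) K
  set v : HeightOneSpectrum (𝓞 K) := w.under (𝓞 K) with hv
  have hw : w.asIdeal.under (𝓞 K) = v.asIdeal := rfl
  have hpv : ((p : ℕ) : 𝓞 K) ∉ v.asIdeal := by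
    intro h
    apply hpw
    have h' : algebraMap (𝓞 K) (𝓞 L) ((p : ℕ) : 𝓞 K) ∈ w.asIdeal := h
    rwa [map_natCast] at h'
  obtain ⟨hunr, hfrob⟩ := hr v hpv (hφ v)
  refine ⟨r.isUnramifiedAt_restrictField hw hunr, ?_⟩
  have hval : (φ.compRelNorm L).valueAtUniformizer w =
      φ.valueAtUniformizer v ^ w.asIdeal.inertiaDeg (𝓞 K) :=
    HeckeCharacter.valueAtUniformizer_eq_pow_of_forall_eq_ideleRelNorm φ (φ.compRelNorm L)
      (fun y ↦ by rw [HeckeCharacter.compRelNorm_apply, automorphic_ideleRelNorm_eq]) (hφ v)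
  rw [hval, map_pow, ← inv_pow]
  rw [FramedGaloisRep.hasFrobCharpolyAt_iff_of_rank_one] at hfrob ⊢
  intro 𝔔 h𝔔 τ hτ
  obtain ⟨𝔓, h𝔓, Φ, hΦ, heq⟩ := r.exists_restrictField_apply_eq_pow hw hunr h𝔔 hτ
  rw [heq, gl_one_pow_apply, hfrob _ h𝔓 Φ hΦ]

/-! ### §2. The bridge and the existence on base-change lines, now unconditional in (B3) -/

/-- **THE BRIDGE, unconditionally in (B3)**: a line frame of `(L, Σ, λ)` along `κ ∘ res` with
`κ(res γ_L) = κ(γ)` is a base-change-line frame along `(κ, γ)` (`KatzCM.IsLine.isBaseChangeLine` with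
`isPAdicAvatarOf_compRelNorm_holds`). [cite: Hsieh2014mu, Prop. 4.9 (§4.8)] [cite: Washington1997, §13.1–13.2] -/
theorem KatzCM.IsLine.isBaseChangeLine' {K L : Type} [Field K] [NumberField K] [Field L]
    [NumberField L] [Algebra K L] [IsGalois K L] {p : ℕ} [Fact p.Prime] {ι : PadicAlgCl p ≃+* ℂ}
    {Sp S T : Finset (HeightOneSpectrum (𝓞 L))} {κ : ZpExtension K p}
    (hs : Function.Surjective (κ.toContinuousMonoidHom.comp (absGaloisRestrict K L)))
    {γ : absoluteGaloisGroup K} {γL : absoluteGaloisGroup L}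
    (hγ : κ (absGaloisRestrict K L γL) = κ γ)
    {lam : HeckeCharacter L} {ϑ : L} {C : ℂ} {Ω : InfinitePlace L → ℂ}
    {Ωp : InfinitePlace L → ℂ_[p]} {G : PowerSeries (PadicComplexInt p)}
    (hG : KatzCM.IsLine ι Sp S T (κ.restrict L hs) γL lam ϑ C Ω Ωp G) :
    KatzCM.IsBaseChangeLine ι Sp S T κ γ lam ϑ C Ω Ωp G :=
  hG.isBaseChangeLine isPAdicAvatarOf_compRelNorm_holds hs hγ

/-- **Existence on every base-change line, unconditionally in (B3)** (still granted the
Katz–Hida–Tilouine existence fact `hsieh2014mu_prop49_exists_isMeasure` and its hypotheses):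
`KatzCM.exists_isBaseChangeLine` with `isPAdicAvatarOf_compRelNorm_holds` supplied.
[cite: Hsieh2014mu, Prop. 4.9 (§4.8)] -/
theorem KatzCM.exists_isBaseChangeLine' {K L : Type} [Field K] [NumberField K] [Field L]
    [NumberField L] [Algebra K L] [IsGalois K L] {p : ℕ} [Fact p.Prime]
    (h : hsieh2014mu_prop49_exists_isMeasure) (hp : 2 < p) [IsCMField L]
    (hunr : ¬ (p : ℤ) ∣ NumberField.discr (maximalRealSubfield L))
    {ι : PadicAlgCl p ≃+* ℂ} {Sp S T D : Finset (HeightOneSpectrum (𝓞 L))}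
    (hSp : KatzCM.IsPAdicCMType p Sp) {ϑ : L} (hϑ₁ : ∀ σ : L →+* ℂ, (σ ϑ).re = 0)
    (hϑ₂ : ∀ σ : L →+* ℂ, KatzCM.InSigma ι Sp σ → 0 < (σ ϑ).im)
    (hS : ∀ w ∈ S, ((p : ℕ) : 𝓞 L) ∉ w.asIdeal) (hTS : T ⊆ S)
    (hT : ∀ w ∈ T, IsCMField.complexConj L • w ≠ w ∧ IsCMField.complexConj L • w ∉ T)
    (hST : ∀ w ∈ S, IsCMField.complexConj L • w ≠ w → (w ∈ T ∨ IsCMField.complexConj L • w ∈ T))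
    (hD₁ : KatzCM.primesOver L p ⊆ D) (hD₂ : S ⊆ D)
    (hD₃ : ∀ w ∈ S, IsCMField.complexConj L • w ∈ D)
    (hD₄ : ∀ w : HeightOneSpectrum (𝓞 L),
      w.asIdeal.ramificationIdx (𝓞 (maximalRealSubfield L)) ≠ 1 → w ∈ D)
    (hd2 : ∀ w ∈ D, ordAt w (2 * ϑ) = differentExponentAt w) {lam : HeckeCharacter L}
    (hlam : ∀ w : HeightOneSpectrum (𝓞 L), w ∉ S → ((p : ℕ) : 𝓞 L) ∉ w.asIdeal →
      lam.IsUnramifiedAt w)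
    {κ : ZpExtension K p}
    (hs : Function.Surjective (κ.toContinuousMonoidHom.comp (absGaloisRestrict K L)))
    {γ : absoluteGaloisGroup K} {γL : absoluteGaloisGroup L} (hγ : κ.IsTopGenerator γ)
    (hγL : (κ.restrict L hs).IsTopGenerator γL) :
    ∃ (C : ℂ) (Ω : InfinitePlace L → ℂ) (Ωp : InfinitePlace L → ℂ_[p])
      (G : PowerSeries (PadicComplexInt p)),
      C ≠ 0 ∧ (∀ w, Ω w ≠ 0) ∧ (∀ w, ‖Ωp w‖ = 1) ∧
        KatzCM.IsBaseChangeLine ι Sp S T κ γ lam ϑ C Ω Ωp G :=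
  KatzCM.exists_isBaseChangeLine h isPAdicAvatarOf_compRelNorm_holds hp hunr hSp hϑ₁ hϑ₂ hS hTS hT
    hST hD₁ hD₂ hD₃ hD₄ hd2 hlam hs hγ hγL

end Discharge

end Literature.NumberTheory.EllipticCurves

end
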